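import Summits.BirchSwinnertonDyer.Rank1Residual.X11b.KolyvaginHpointsAssembly
import Summits.BirchSwinnertonDyer.Rank1Residual.X11b.KolyvaginReciprocityOfPoitouTate
import HarnessLib

/-!
# `Kolyvagin1990_sha_primary_finite` in its CURRENT RESIDUAL FORM with leaf (A′) ASSEMBLED:
# Ш(E/K)[p^∞] finite ⟸ the cite-only printed inputs of Gross §§3–6 + (R)_M + [K1] + the CM/`d_K`
# leaf — the end-to-end composition at concrete currency

Cell `b2b-bsdres`, team x11b3 (N8/O2); seat x11b3-p2 GEN 13 ((P2-ASM-PRECERT), INBOX l.7236),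
companion of `X11b/KolyvaginHpointsAssembly`.  Summit-side THEOREM-ONLY file (no definition, no
named fact, no `sorry`); `K : Type`.

HONEST FRAMING (binding): **plumbing — a COMPOSITION of two tree theorems, nothing discharged.**
`KolyvaginDescent.Kolyvagin1990_sha_primary_finite_of_pointsM_of_reciprocityM` (Literature,
`HeegnerPointsKolyvaginPrimaryAssemblyProofs`) reduces the named fact
`Kolyvagin1990_sha_primary_finite N W K` (Gross 1991 Thm. 1.3 (2), `p`-primary part; McCallum 1991
§1) to {`hexc`, `hpoints`, `hR`, `hK1`}; `KolyvaginAssembly.hpoints_of_perLevelChoice` assembles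
`hpoints` at concrete currency from the LABELLED cite-only inputs {`hrec`, `hCM`, `h53`, `hGZ`,
`hγ`} (+ `hN : N = N_E`, `W` globally minimal).  THIS FILE is the one-line composition, so that the
residual form of the fact reads, for a globally minimal `W` at its conductor:
`Kolyvagin1990_sha_primary_finite N W K` ⟸
(i) `hexc` — the tree's leaf `Kolyvagin1990_thmA_of_hasCM_or_discr` (CM or `d_K ∈ {−3, −4}`);
(ii) `hrec` — Shimura reciprocity at conductor 1 (named fact
`heegnerPointOfConductor_one_galoisConj`);
(iii) `hCM` — Gross §3, `x_m` rational over `K_m` (CM theory);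
(iv) `h53` — (A′-53) = Gross Prop. 5.3 at conductor `m`, printed form, `ε = −w(E)`;
(v) `hGZ` — [GZ86 III (3.1)] as Gross p. 245 uses it;
(vi) `hγ` — (γ) = Gross Prop. 3.7 (2);
(vii) `hR` — Kolyvagin reciprocity (R)_M at every Kolyvagin prime (McCallum Prop. 2.2 at `λ`);
(viii) `hK1` — [K1, Thm. A] for `p = 2` or `ρ̄_{E,p}` not onto;
all cite-only labelled hypotheses, NOT Literature facts, NOT discharged here; the Čebotarev
density theorem, the Weil pairing, leaf (B), Gross Lemma 4.3 (image), McCallum (4), the inertia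
clause, `d_K < −4`, `(N, d_K) = 1` are tree theorems consumed inside.  Node `Three.HsiehDescentAt₃`
and its antecedents untouched; nothing booked; no mark / label / count / tier moves.

## What is proved

* **`KolyvaginAssembly.sha_primary_finite_of_leafInputs_of_reciprocityM`** — the composition.
* `KolyvaginAssembly.sha_primary_finite_of_leafInputs_of_poitouTate` — the same with `hR` SUPPLIED
  modulo the Poitou–Tate named fact `hPT` (x11b3-p1/p3's
  `KolyvaginReciprocity.Kolyvagin1990_sha_primary_finite_of_pointsM_of_poitouTate`): telescope
  {`hPT`, `hexc`, `hrec`, `hCM`, `h53`, `hGZ`, `hγ`, `hK1`} — every entry a named fact or a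
  cite-only printed input.

## References

* [GrossLMS1991] B. H. Gross, *Kolyvagin's work on modular elliptic curves*, LMS LNS 153 (1991),
  Thm. 1.3 (2), §§3–8 (held `book:editornd-l-functions-arithmetic`, chunks 212–226).
* [McCallumLMS1991] W. G. McCallum, *Kolyvagin's work on Shafarevich–Tate groups*, same volume,
  §1 Theorem, Prop. 2.2, §§4–5.
* [Kolyvagin1990] V. A. Kolyvagin, *Euler systems*, Grothendieck Festschrift II (1990), Thm. A
  (cite only; not held).

presearch: composition of two tree theorems; `lean search 'sha_primary_finite_of_leafInputs'` →
no matches (INTENT-grep); literature as in `X11b/KolyvaginHpointsAssembly`.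
-/

noncomputable section

open scoped Classical
open WeierstrassCurve Field NumberField IsDedekindDomain
open Literature.NumberTheory.EllipticCurves Literature.NumberTheory.GaloisRepresentations
open Literature.NumberTheory.EllipticCurves.RingClassField
open Literature.NumberTheory.EllipticCurves.ModularForms

namespace Summit.BirchSwinnertonDyer.Rank1Residual.X11b.KolyvaginAssembly

-- `K : Type`: the tree's ring-class class field theory is universe `0`.
variable {K : Type} [Field K] [NumberField K] {N : ℕ} {W : WeierstrassCurve ℚ}

/-- **`Kolyvagin1990_sha_primary_finite N W K` — Ш(E/K)[p^∞] finite for every prime `p`, `E`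
with a globally minimal model `W` at its conductor `N`, `K` imaginary quadratic with the Heegner
hypothesis and a non-torsion Heegner point — from the cite-only printed inputs** (Gross 1991
Thm. 1.3 (2) along Gross §§3–8 / McCallum §§4–5): the composition of
`KolyvaginDescent.Kolyvagin1990_sha_primary_finite_of_pointsM_of_reciprocityM` with
`KolyvaginAssembly.hpoints_of_perLevelChoice`.  CONDITIONAL on EXACTLY the labelled hypotheses
`hexc` (CM / `d_K ∈ {−3,−4}` leaf), `hrec` (Shimura reciprocity at conductor 1, named fact),
`hCM` (Gross §3 CM rationality), `h53` ((A′-53)), `hGZ` ([GZ86 III (3.1)]), `hγ` ((γ)), `hR`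
((R)_M) and `hK1` ([K1] off the surjective odd cell), plus `hN : N = N_E`; cite-only, NOT facts,
NOT discharged; nothing booked. [cite: GrossLMS1991, Thm. 1.3 (2), §§3–8]
[cite: McCallumLMS1991, §1 Theorem, Prop. 2.2, §§4–5] -/
theorem sha_primary_finite_of_leafInputs_of_reciprocityM [NeZero N] [W.IsGloballyMinimal]
    (hN : ∀ [W.IsElliptic], N = W.conductorNorm ℤ)
    (hrec : heegnerPointOfConductor_one_galoisConj N W K)
    (hCM : ∀ [W.IsElliptic] (_hK : IsImaginaryQuadratic K) (_hH : SatisfiesHeegnerHypothesis N K)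
      (Dt : ModularParametrizationData W N) (β : ℤ) (ι : K →+* ℂ),
      (4 * N : ℤ) ∣ β ^ 2 - NumberField.discr K →
      ∀ {p M : ℕ}, p.Prime → 1 ≤ M → ∀ (m : ℕ), Squarefree m →
      (∀ q ∈ m.primeFactors, IsKolyvaginPrime N W K p q ∧ FrobEqFrobInfty W K (p ^ M) q) →
      ∃ y : (W.baseChange (ringClassField K ι m)).toAffine.Point,
        WeierstrassCurve.Affine.Point.map (W' := W) (ringClassField K ι m).subtype.toRatAlgHom y =
          heegnerPointComplexOfConductor Dt (NumberField.discr K) β m)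
    (h53 : ∀ [W.IsElliptic] (_hK : IsImaginaryQuadratic K) (_hH : SatisfiesHeegnerHypothesis N K)
      (Dt : ModularParametrizationData W N) (β : ℤ) (ι : K →+* ℂ) {p M : ℕ} (_hp : p.Prime)
      (_hM : 1 ≤ M) {n : ℕ} (_hn : Squarefree n)
      (_hKol : ∀ q ∈ n.primeFactors, IsKolyvaginPrime N W K p q ∧ FrobEqFrobInfty W K (p ^ M) q)
      (d : (m : ℕ) → m ∣ n → KolyvaginHeegnerData Dt β ι m) (m : ℕ) (hm : m ∣ n)
      (τm : ringClassField K ι m ≃ₐ[ℚ] ringClassField K ι m),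
      (∀ x : ringClassField K ι m, ((τm x : ringClassField K ι m) : ℂ) = starRingEnd ℂ x) →
      ∃ σ' ∈ ringClassGal ι m, IsOfFinAddOrder
        (pointGalHom W (ringClassField K ι m) τm (d m hm).y -
          (-W.rootNumber) • pointGalHom W (ringClassField K ι m) σ' (d m hm).y))
    (hGZ : ∀ [W.IsElliptic] (_hK : IsImaginaryQuadratic K) (_hH : SatisfiesHeegnerHypothesis N K)
      (Dt : ModularParametrizationData W N) (β : ℤ) (ι : K →+* ℂ) {p M : ℕ} (_hp : p.Prime)
      (_hp2 : p ≠ 2) (_hρ : W.HasSurjectiveModNGaloisRep p) (_hM : 1 ≤ M) {n : ℕ}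
      (_hn : Squarefree n)
      (_hKol : ∀ q ∈ n.primeFactors, IsKolyvaginPrime N W K p q ∧ FrobEqFrobInfty W K (p ^ M) q)
      (d : (m : ℕ) → m ∣ n → KolyvaginHeegnerData Dt β ι m),
      ∃ n' : ℤ, IsCoprime ((p ^ M : ℕ) : ℤ) n' ∧
        ∀ (m : ℕ) (hm : m ∣ n) (γ : ringClassField K ι m ≃ₐ[ℚ] ringClassField K ι m),
          γ ∈ ringClassGal ι m → ∀ v : HeightOneSpectrum (𝓞 K),
            ¬ (W.baseChange K).HasGoodReductionAt v →
            n' • pointsMap (W.baseChange K) (v.adicCompletion K)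
                ((d m hm).toGeomPoints (pointGalHom W (ringClassField K ι m) γ (d m hm).y)) ∈
              E0Receptacle (W.baseChange K) v ∧
            ∀ (ℓ : ℕ) (hℓ : ℓ ∈ m.primeFactors)
              (hle : ringClassField K ι (m / ℓ) ≤ ringClassField K ι m),
              n' • pointsMap (W.baseChange K) (v.adicCompletion K)
                  ((d m hm).toGeomPoints (pointGalHom W (ringClassField K ι m) γ
                    (WeierstrassCurve.Affine.Point.map (W' := W)
                      ((RingClassField.inclusion ι hle).restrictScalars ℚ)
                      (d (m / ℓ)
                        ((Nat.div_dvd_of_dvd (Nat.dvd_of_mem_primeFactors hℓ)).trans hm)).y))) ∈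
                E0Receptacle (W.baseChange K) v)
    (hγ : ∀ [W.IsElliptic] (_hK : IsImaginaryQuadratic K) (_hH : SatisfiesHeegnerHypothesis N K)
      (Dt : ModularParametrizationData W N) (β : ℤ) (ι : K →+* ℂ) {p M : ℕ} (_hp : p.Prime)
      (_hM : 1 ≤ M) {n : ℕ} (_hn : Squarefree n)
      (_hKol : ∀ q ∈ n.primeFactors, IsKolyvaginPrime N W K p q ∧ FrobEqFrobInfty W K (p ^ M) q)
      (d : (m : ℕ) → m ∣ n → KolyvaginHeegnerData Dt β ι m)
      (m : ℕ) (hm : m ∣ n) (ℓ : ℕ) (hℓ : ℓ ∈ m.primeFactors) [Fact ℓ.Prime]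
      (hΔ : ¬ (ℓ : ℤ) ∣ minimalDiscriminantInt W) (φ₀ : absoluteGaloisGroup (ZMod ℓ)),
      (∀ x : AlgebraicClosure (ZMod ℓ), φ₀ • x = x ^ ℓ) →
      ∀ (hle : ringClassField K ι (m / ℓ) ≤ ringClassField K ι m)
        (γ : ringClassField K ι m ≃ₐ[ℚ] ringClassField K ι m), γ ∈ ringClassGal ι m →
        geomReduction hΔ ((RatClosure.pointsEquiv (K := K) W).symm
            ((d m hm).toGeomPoints (pointGalHom W (ringClassField K ι m) γ (d m hm).y))) =
          φ₀ • geomReduction hΔ ((RatClosure.pointsEquiv (K := K) W).symm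
            ((d m hm).toGeomPoints (pointGalHom W (ringClassField K ι m) γ
              (WeierstrassCurve.Affine.Point.map (W' := W)
                ((RingClassField.inclusion ι hle).restrictScalars ℚ)
                (d (m / ℓ)
                  ((Nat.div_dvd_of_dvd (Nat.dvd_of_mem_primeFactors hℓ)).trans hm)).y)))))
    (hexc : Kolyvagin1990_thmA_of_hasCM_or_discr N W K)
    (hR : ∀ [W.IsElliptic] (_hE : ¬ W.HasCM) (_hK : IsImaginaryQuadratic K)
      (_hD : NumberField.discr K ≠ -3 ∧ NumberField.discr K ≠ -4)
      (_hH : SatisfiesHeegnerHypothesis N K)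
      {P : (W.baseChange K).toAffine.Point} (_hP : IsHeegnerPoint N W K P)
      (_hnt : ¬ IsOfFinAddOrder P) {p : ℕ} (_hp : p.Prime) (_hp2 : p ≠ 2)
      (_hρ : W.HasSurjectiveModNGaloisRep p) {M : ℕ} (_hM : 1 ≤ M)
      {ℓ : ℕ} (hℓ : IsKolyvaginPrime N W K p ℓ), FrobEqFrobInfty W K (p ^ M) ℓ →
      ∃ (A : Type) (_ : AddCommGroup A)
        (e : geomTorsion (W.baseChange K) ((p ^ M : ℕ) : ℤ) →+
          geomTorsion (W.baseChange K) ((p ^ M : ℕ) : ℤ) →+ A),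
        (∀ x, e x x = 0) ∧ (∀ x, (∀ y, e x y = 0) → x = 0) ∧
        ∀ s ∈ selmerGroup (W.baseChange K) ((p ^ M : ℕ) : ℤ),
          ∀ c' : galH1Torsion (W.baseChange K) ((p ^ M : ℕ) : ℤ),
          (∀ v : HeightOneSpectrum (𝓞 K), (ℓ : 𝓞 K) ∉ v.asIdeal →
            c' ∈ selmerLocalKer (W.baseChange K) (v.adicCompletion K) ((p ^ M : ℕ) : ℤ)) →
          (∀ w : InfinitePlace K,
            c' ∈ selmerLocalKer (W.baseChange K) w.Completion ((p ^ M : ℕ) : ℤ)) →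
          ∀ 𝔔 ∈ hℓ.place.primesAbove, ∀ F : Field.absoluteGaloisGroup K,
            IsArithFrobAt (𝓞 K) F 𝔔 →
            F ∈ torsionFixing (W.baseChange K) ((p ^ M : ℕ) : ℤ) →
            ∀ σ ∈ 𝔔.inertia (Field.absoluteGaloisGroup K),
            e (h1Eval (W.baseChange K) ((p ^ M : ℕ) : ℤ) s F)
              (h1Eval (W.baseChange K) ((p ^ M : ℕ) : ℤ) c' σ) = 0)
    (hK1 : ∀ [W.IsElliptic] (_hE : ¬ W.HasCM)
      (_hD : NumberField.discr K ≠ -3 ∧ NumberField.discr K ≠ -4) (_hK : IsImaginaryQuadratic K)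
      (_hH : SatisfiesHeegnerHypothesis N K) {P : (W.baseChange K).toAffine.Point}
      (_hP : IsHeegnerPoint N W K P) (_hnt : ¬ IsOfFinAddOrder P) (p : ℕ) (_hp : p.Prime),
      (p = 2 ∨ ¬ W.HasSurjectiveModNGaloisRep p) →
      Set.Finite {c : (W.baseChange K).sha | ∃ j : ℕ, p ^ j • c = 0}) :
    Kolyvagin1990_sha_primary_finite N W K :=
  KolyvaginDescent.Kolyvagin1990_sha_primary_finite_of_pointsM_of_reciprocityM N W K hexc
    (@hpoints_of_perLevelChoice K _ _ N W _ _ hN hrec hCM h53 hGZ hγ) hR hK1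

/-- **The same with Kolyvagin reciprocity (R)_M SUPPLIED modulo the Poitou–Tate named fact**
(`KolyvaginReciprocity.Kolyvagin1990_sha_primary_finite_of_pointsM_of_poitouTate`, x11b3-p1 /
x11b3-p3: McCallum Prop. 2.2 at `λ` from
`GaloisCohomology.poitouTate_sum_localTatePairing_eq_zero`): the
Kolyvagin-side telescope with `hR` replaced by `hPT`.  CONDITIONAL on EXACTLY {`hPT` (existing
named fact), `hexc`, `hrec`, `hCM`, `h53`, `hGZ`, `hγ`, `hK1`} + `hN`; cite-only, NOT discharged;
nothing booked. [cite: McCallumLMS1991, §1 Theorem, Prop. 2.2] [cite: GrossLMS1991, Thm. 1.3 (2)] -/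
theorem sha_primary_finite_of_leafInputs_of_poitouTate [NeZero N] [W.IsGloballyMinimal]
    (hPT : Literature.NumberTheory.GaloisCohomology.poitouTate_sum_localTatePairing_eq_zero K)
    (hexc : Kolyvagin1990_thmA_of_hasCM_or_discr N W K)
    (hN : ∀ [W.IsElliptic], N = W.conductorNorm ℤ)
    (hrec : heegnerPointOfConductor_one_galoisConj N W K)
    (hCM : ∀ [W.IsElliptic] (_hK : IsImaginaryQuadratic K) (_hH : SatisfiesHeegnerHypothesis N K)
      (Dt : ModularParametrizationData W N) (β : ℤ) (ι : K →+* ℂ),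
      (4 * N : ℤ) ∣ β ^ 2 - NumberField.discr K →
      ∀ {p M : ℕ}, p.Prime → 1 ≤ M → ∀ (m : ℕ), Squarefree m →
      (∀ q ∈ m.primeFactors, IsKolyvaginPrime N W K p q ∧ FrobEqFrobInfty W K (p ^ M) q) →
      ∃ y : (W.baseChange (ringClassField K ι m)).toAffine.Point,
        WeierstrassCurve.Affine.Point.map (W' := W) (ringClassField K ι m).subtype.toRatAlgHom y =
          heegnerPointComplexOfConductor Dt (NumberField.discr K) β m)
    (h53 : ∀ [W.IsElliptic] (_hK : IsImaginaryQuadratic K) (_hH : SatisfiesHeegnerHypothesis N K)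
      (Dt : ModularParametrizationData W N) (β : ℤ) (ι : K →+* ℂ) {p M : ℕ} (_hp : p.Prime)
      (_hM : 1 ≤ M) {n : ℕ} (_hn : Squarefree n)
      (_hKol : ∀ q ∈ n.primeFactors, IsKolyvaginPrime N W K p q ∧ FrobEqFrobInfty W K (p ^ M) q)
      (d : (m : ℕ) → m ∣ n → KolyvaginHeegnerData Dt β ι m) (m : ℕ) (hm : m ∣ n)
      (τm : ringClassField K ι m ≃ₐ[ℚ] ringClassField K ι m),
      (∀ x : ringClassField K ι m, ((τm x : ringClassField K ι m) : ℂ) = starRingEnd ℂ x) →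
      ∃ σ' ∈ ringClassGal ι m, IsOfFinAddOrder
        (pointGalHom W (ringClassField K ι m) τm (d m hm).y -
          (-W.rootNumber) • pointGalHom W (ringClassField K ι m) σ' (d m hm).y))
    (hGZ : ∀ [W.IsElliptic] (_hK : IsImaginaryQuadratic K) (_hH : SatisfiesHeegnerHypothesis N K)
      (Dt : ModularParametrizationData W N) (β : ℤ) (ι : K →+* ℂ) {p M : ℕ} (_hp : p.Prime)
      (_hp2 : p ≠ 2) (_hρ : W.HasSurjectiveModNGaloisRep p) (_hM : 1 ≤ M) {n : ℕ}
      (_hn : Squarefree n)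
      (_hKol : ∀ q ∈ n.primeFactors, IsKolyvaginPrime N W K p q ∧ FrobEqFrobInfty W K (p ^ M) q)
      (d : (m : ℕ) → m ∣ n → KolyvaginHeegnerData Dt β ι m),
      ∃ n' : ℤ, IsCoprime ((p ^ M : ℕ) : ℤ) n' ∧
        ∀ (m : ℕ) (hm : m ∣ n) (γ : ringClassField K ι m ≃ₐ[ℚ] ringClassField K ι m),
          γ ∈ ringClassGal ι m → ∀ v : HeightOneSpectrum (𝓞 K),
            ¬ (W.baseChange K).HasGoodReductionAt v →
            n' • pointsMap (W.baseChange K) (v.adicCompletion K)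
                ((d m hm).toGeomPoints (pointGalHom W (ringClassField K ι m) γ (d m hm).y)) ∈
              E0Receptacle (W.baseChange K) v ∧
            ∀ (ℓ : ℕ) (hℓ : ℓ ∈ m.primeFactors)
              (hle : ringClassField K ι (m / ℓ) ≤ ringClassField K ι m),
              n' • pointsMap (W.baseChange K) (v.adicCompletion K)
                  ((d m hm).toGeomPoints (pointGalHom W (ringClassField K ι m) γ
                    (WeierstrassCurve.Affine.Point.map (W' := W)
                      ((RingClassField.inclusion ι hle).restrictScalars ℚ)
                      (d (m / ℓ)
                        ((Nat.div_dvd_of_dvd (Nat.dvd_of_mem_primeFactors hℓ)).trans hm)).y))) ∈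
                E0Receptacle (W.baseChange K) v)
    (hγ : ∀ [W.IsElliptic] (_hK : IsImaginaryQuadratic K) (_hH : SatisfiesHeegnerHypothesis N K)
      (Dt : ModularParametrizationData W N) (β : ℤ) (ι : K →+* ℂ) {p M : ℕ} (_hp : p.Prime)
      (_hM : 1 ≤ M) {n : ℕ} (_hn : Squarefree n)
      (_hKol : ∀ q ∈ n.primeFactors, IsKolyvaginPrime N W K p q ∧ FrobEqFrobInfty W K (p ^ M) q)
      (d : (m : ℕ) → m ∣ n → KolyvaginHeegnerData Dt β ι m)
      (m : ℕ) (hm : m ∣ n) (ℓ : ℕ) (hℓ : ℓ ∈ m.primeFactors) [Fact ℓ.Prime]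
      (hΔ : ¬ (ℓ : ℤ) ∣ minimalDiscriminantInt W) (φ₀ : absoluteGaloisGroup (ZMod ℓ)),
      (∀ x : AlgebraicClosure (ZMod ℓ), φ₀ • x = x ^ ℓ) →
      ∀ (hle : ringClassField K ι (m / ℓ) ≤ ringClassField K ι m)
        (γ : ringClassField K ι m ≃ₐ[ℚ] ringClassField K ι m), γ ∈ ringClassGal ι m →
        geomReduction hΔ ((RatClosure.pointsEquiv (K := K) W).symm
            ((d m hm).toGeomPoints (pointGalHom W (ringClassField K ι m) γ (d m hm).y))) =
          φ₀ • geomReduction hΔ ((RatClosure.pointsEquiv (K := K) W).symm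
            ((d m hm).toGeomPoints (pointGalHom W (ringClassField K ι m) γ
              (WeierstrassCurve.Affine.Point.map (W' := W)
                ((RingClassField.inclusion ι hle).restrictScalars ℚ)
                (d (m / ℓ)
                  ((Nat.div_dvd_of_dvd (Nat.dvd_of_mem_primeFactors hℓ)).trans hm)).y)))))
    (hK1 : ∀ [W.IsElliptic] (_hE : ¬ W.HasCM)
      (_hD : NumberField.discr K ≠ -3 ∧ NumberField.discr K ≠ -4) (_hK : IsImaginaryQuadratic K)
      (_hH : SatisfiesHeegnerHypothesis N K) {P : (W.baseChange K).toAffine.Point}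
      (_hP : IsHeegnerPoint N W K P) (_hnt : ¬ IsOfFinAddOrder P) (p : ℕ) (_hp : p.Prime),
      (p = 2 ∨ ¬ W.HasSurjectiveModNGaloisRep p) →
      Set.Finite {c : (W.baseChange K).sha | ∃ j : ℕ, p ^ j • c = 0}) :
    Kolyvagin1990_sha_primary_finite N W K :=
  KolyvaginReciprocity.Kolyvagin1990_sha_primary_finite_of_pointsM_of_poitouTate N W K hPT hexc
    (@hpoints_of_perLevelChoice K _ _ N W _ _ hN hrec hCM h53 hGZ hγ) hK1

end Summit.BirchSwinnertonDyer.Rank1Residual.X11b.KolyvaginAssembly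

end
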